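import Literature.MathematicalPhysics.QuantumManyBody.PeriodicBoseGasBounded
import HarnessLib

/-!
# Fournais 2020, (3.15)–(3.17) from Theorem 2.1 on bounded states

Topic `Literature/MathematicalPhysics/QuantumManyBody` (provefact
`Literature.MathematicalPhysics.QuantumManyBody.BoseGas.Fournais2020_eq317`). The display
[Fournais2020, (3.17)] — for all `N`, all `u ∈ Ω` and all periodic `N`-body states `Ψ`,
`⟨Ψ, (∑ᵢ T_u^{(i)} + W_{u,N}) Ψ⟩ ≥ -4πρ_μ²aℓ³(1 + C₀(ρ_μa³)^{1/2})` (`Fournais2020_eq317`,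
`PeriodicBoseGasLocalization.lean`) — is derived in `PeriodicBoseGasEq317.lean` from the small-box
theorem [Fournais2020, Thm. 2.1] stated for *all* symmetric measurable states of the box
(`Fournais2020_thm21`). The only states that argument ever feeds into Thm. 2.1 are the sections
`Φ_{S,Y} = Ψ(· ⊔ Y)` of a periodic `C¹` trial state `Ψ` (`PeriodicTrialState`), and a continuous
periodic function is **bounded** (`PeriodicTrialState.exists_norm_le`: it takes all its values on the
compact closure of the fundamental cell). Hence (3.17) already follows from Thm. 2.1 restricted to
bounded states, `Fournais2020_thm21_bdd` (`PeriodicBoseGasBounded.lean`), which is the form in which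
Thm. 2.1 is reached from [Fournais2020, (2.29)] on bounded states in this topic:

* `Fournais2020_eq317_of_thm21_bdd : Fournais2020_thm21_bdd → Fournais2020_eq317`.

The proof is that of `Fournais2020_eq317_of_thm21` verbatim ((3.16): shift of the fundamental cell to
`Ω'(u)^N ⊇ Λ(u)^N`, un-periodisation, decomposition `Ω'^N = ⊔_S Λ^S × (Ω'∖Λ)^{Sᶜ}`, Thm. 2.1 on each
`|S|`-sector, "the natural identifications"), with the boundedness of `Φ_{S,Y}` supplied at the one
place where Thm. 2.1 is invoked. The local notations of `PeriodicBoseGasEq317.lean` (the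
splitting equivalence `(ℝ³)^N ≃ᵐ (ℝ³)^{|S|} × (ℝ³)^{Sᶜ}`, the shifted cell `Ω'(u)`, the lattice
basis of `(Lℤ³)^N`) are spelled out in full here, so that its lemmas apply verbatim. No new
definitions, no notation.

## References

* [Fournais2020] S. Fournais, *Length scales for BEC in the dilute Bose gas*, arXiv:2011.00309,
  EMS Ser. Congr. Rep. 18 (2021), doi:10.4171/ecr/18-1/7: Thm. 2.1 (2.11), (2.6), (3.14)–(3.17).
* [BrietzkeFournaisSolovej2020] B. Brietzke, S. Fournais, J. P. Solovej, *A simple 2nd order lower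
  bound to the energy of dilute Bose gases*, Comm. Math. Phys. 376 (2020) 323–351: Thm. 6.1.
-/

noncomputable section

open MeasureTheory Filter Set WithLp
open scoped ENNReal NNReal Topology Pointwise

namespace Literature.MathematicalPhysics.QuantumManyBody.BoseGas

variable {N : ℕ} {L : ℝ}

/-! ### Periodic continuous states are bounded -/

/-- Points of the fundamental cell `[0,L)^{3N}` have norm at most `2L`. [folklore] -/
theorem norm_le_of_mem_cellN (hL : 0 < L) {X : Config N} (hX : X ∈ cellN N L) : ‖X‖ ≤ 2 * L := by
  rw [pi_norm_le_iff_of_nonneg (by linarith)]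
  intro i
  have hk : ∀ k, X i k ∈ Set.Ico 0 L := hX i
  have h2 : ‖X i‖ ^ 2 ≤ 3 * L ^ 2 := by
    rw [EuclideanSpace.norm_sq_eq]
    calc ∑ k, ‖X i k‖ ^ 2 ≤ ∑ _k : Fin 3, L ^ 2 :=
          Finset.sum_le_sum fun k _ => by
            have h := hk k
            rw [Set.mem_Ico] at h
            rw [Real.norm_eq_abs, abs_of_nonneg h.1]
            exact pow_le_pow_left₀ h.1 h.2.le 2
      _ = 3 * L ^ 2 := by simp
  nlinarith [norm_nonneg (X i)]

/-- **A periodic continuous `N`-body function is bounded**: a periodic `C¹` trial state `Ψ` takes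
every value already on the fundamental cell `[0,L)^{3N}` (reduction modulo the period lattice
`(Lℤ³)^N`, `ZSpan.fract`), whose closure is compact. [folklore] -/
theorem PeriodicTrialState.exists_norm_le (hL : 0 < L) (Ψ : PeriodicTrialState N L) :
    ∃ C : ℝ, ∀ X, ‖Ψ.ψ X‖ ≤ C := by
  obtain ⟨C, hC⟩ := (isCompact_closedBall (0 : Config N) (2 * L)).exists_bound_of_continuousOn
    Ψ.contDiff.continuous.continuousOn
  refine ⟨C, fun X => ?_⟩
  have hmem : ZSpan.fract ((Pi.basis fun _ : Fin N => (EuclideanSpace.basisFun (Fin 3) ℝ).toBasis.unitsSMul fun _ : Fin 3 => Units.mk0 _ (ne_of_gt hL) : Module.Basis (Σ _ : Fin N, Fin 3) ℝ (Config N))) X ∈ cellN N L := by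
    rw [← fundamentalDomain_latticeBasisN hL]
    exact ZSpan.fract_mem_fundamentalDomain _ X
  -- `|Ψ|` is invariant under the period lattice, and `X = ⌊X⌋ + fract X`
  have hper := periodic_zspan hL (G := fun X => (‖Ψ.ψ X‖₊ : ℝ≥0∞))
    (fun X i k => by simp only [Ψ.periodic])
    ⟨(ZSpan.floor ((Pi.basis fun _ : Fin N => (EuclideanSpace.basisFun (Fin 3) ℝ).toBasis.unitsSMul fun _ : Fin 3 => Units.mk0 _ (ne_of_gt hL) : Module.Basis (Σ _ : Fin N, Fin 3) ℝ (Config N))) X : Config N), (ZSpan.floor ((Pi.basis fun _ : Fin N => (EuclideanSpace.basisFun (Fin 3) ℝ).toBasis.unitsSMul fun _ : Fin 3 => Units.mk0 _ (ne_of_gt hL) : Module.Basis (Σ _ : Fin N, Fin 3) ℝ (Config N))) X).2⟩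
    (ZSpan.fract ((Pi.basis fun _ : Fin N => (EuclideanSpace.basisFun (Fin 3) ℝ).toBasis.unitsSMul fun _ : Fin 3 => Units.mk0 _ (ne_of_gt hL) : Module.Basis (Σ _ : Fin N, Fin 3) ℝ (Config N))) X)
  rw [AddSubgroup.vadd_def, vadd_eq_add] at hper
  have hX : (ZSpan.floor ((Pi.basis fun _ : Fin N => (EuclideanSpace.basisFun (Fin 3) ℝ).toBasis.unitsSMul fun _ : Fin 3 => Units.mk0 _ (ne_of_gt hL) : Module.Basis (Σ _ : Fin N, Fin 3) ℝ (Config N))) X : Config N) + ZSpan.fract ((Pi.basis fun _ : Fin N => (EuclideanSpace.basisFun (Fin 3) ℝ).toBasis.unitsSMul fun _ : Fin 3 => Units.mk0 _ (ne_of_gt hL) : Module.Basis (Σ _ : Fin N, Fin 3) ℝ (Config N))) X = X := by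
    rw [ZSpan.fract_apply]; abel
  simp only [hX, ENNReal.coe_inj] at hper
  have hn : ‖Ψ.ψ X‖ = ‖Ψ.ψ (ZSpan.fract ((Pi.basis fun _ : Fin N => (EuclideanSpace.basisFun (Fin 3) ℝ).toBasis.unitsSMul fun _ : Fin 3 => Units.mk0 _ (ne_of_gt hL) : Module.Basis (Σ _ : Fin N, Fin 3) ℝ (Config N))) X)‖ := by
    have h := congrArg (fun t : ℝ≥0 => (t : ℝ)) hper
    simpa only [coe_nnnorm] using h
  rw [hn]
  refine hC _ (Metric.mem_closedBall.2 ?_)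
  rw [dist_zero_right]
  exact norm_le_of_mem_cellN hL hmem

/-- The sections `Φ_{S,Y} = Ψ(· ⊔ Y)` of a bounded function are bounded (by the same constant).
[folklore] -/
theorem exists_norm_split_symm_le (S : Finset (Fin N)) {Ψ : Config N → ℂ} (hΨ : ∃ C : ℝ, ∀ X, ‖Ψ X‖ ≤ C)
    (Y : {i // i ∉ S} → Space) :
    ∃ C : ℝ, ∀ Z : Config S.card, ‖Ψ ((MeasurableEquiv.trans (MeasurableEquiv.piEquivPiSubtypeProd (fun _ : Fin _ => Space) (fun i => i ∈ S)) (MeasurableEquiv.prodCongr (MeasurableEquiv.symm (MeasurableEquiv.piCongrLeft (fun _ : {i // i ∈ S} => Space) (RelIso.toEquiv (Finset.orderIsoOfFin S rfl)))) (MeasurableEquiv.refl ({i // i ∉ S} → Space)))).symm (Z, Y))‖ ≤ C := by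
  obtain ⟨C, hC⟩ := hΨ
  exact ⟨C, fun Z => hC _⟩

/-! ### Assembly: (3.17) from Theorem 2.1 on bounded states -/

/-- **Fournais 2020, (3.17) from Theorem 2.1 on bounded states.** The small-box bound
[Fournais2020, Thm. 2.1] restricted to bounded symmetric states of the box (`Fournais2020_thm21_bdd`)
implies the display (3.17) on the torus: for `u ∈ Ω`, `2ℓ < L` (and `R ≤ ℓ`, forced by the
smallness of `ρ_μa³`), and every periodic `N`-body state `Ψ`,
`⟨Ψ, (∑ᵢ T_u^{(i)} + W_{u,N}) Ψ⟩ ≥ -4πρ_μ²aℓ³(1 + C₀(ρ_μa³)^{1/2})`, by decomposing `Ψ` on the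
shifted cell `Ω'(u)^N ⊇ Λ(u)^N` according to the set `S` of particles in `Λ(u)` and applying
Thm. 2.1 to each (bounded, symmetric) `Φ_{S,Y} = Ψ(·, Y)`, `Y ∈ (Ω' ∖ Λ)^{Sᶜ}` ("the natural
identifications" (3.16)); the proof of `Fournais2020_eq317_of_thm21` verbatim.
[cite: Fournais2020, (3.15)–(3.17), Thm. 2.1 (2.11)] -/
theorem Fournais2020_eq317_of_thm21_bdd (h21 : Fournais2020_thm21_bdd) : Fournais2020_eq317 := by
  intro v hv hint ha ω hω χ hχ b s hb hs
  obtain ⟨hvmeas, R₀, hR₀⟩ := hv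
  obtain ⟨K₀, hK₀, H21⟩ := h21 v ⟨hvmeas, R₀, hR₀⟩ hint ha ω hω χ hχ b s hb hs
  refine ⟨K₀, hK₀, fun K hK => ?_⟩
  obtain ⟨C₀, c, hC₀, hc, H⟩ := H21 K hK
  have ha0 : 0 < (scatteringLength v).toReal := scatteringLength_toReal_pos hint ha
  have hKpos : 0 < K := hK₀.trans_le hK
  set R : ℝ := max R₀ 0 + 1 with hRdef
  have hRpos : 0 < R := by have := le_max_right R₀ 0; linarith
  have hR : ∀ r, R ≤ r → v r = 0 := fun r hr => hR₀ r (by have := le_max_left R₀ 0; linarith)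
  refine ⟨C₀, min c ((R * K)⁻¹ ^ 2 * (scatteringLength v).toReal ^ 2), hC₀, lt_min hc (by positivity),
    ?_⟩
  intro ρμ N L hρμ hL
  dsimp only
  intro hρc h2ℓ u hu Ψ
  set a : ℝ := (scatteringLength v).toReal with hadef
  set ℓ : ℝ := boxLength K ρμ a with hℓdef
  have hχc : Continuous χ := hχ.contDiff.continuous
  have hΨc : Continuous Ψ.ψ := Ψ.contDiff.continuous
  have hΨbdd : ∃ C : ℝ, ∀ X, ‖Ψ.ψ X‖ ≤ C := Ψ.exists_norm_le hL
  have hρc' : ρμ * a ^ 3 ≤ c := hρc.trans (min_le_left _ _)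
  have hsq : 0 < Real.sqrt (ρμ * a) := Real.sqrt_pos.2 (by positivity)
  have hℓ0 : 0 < ℓ := by rw [hℓdef, boxLength]; positivity
  have hℓL : ℓ < L := by linarith
  -- `R ≤ ℓ` from `ρ_μ a³ ≤ a²/(RK)²`
  have hRℓ : R ≤ ℓ := by
    have h1 : ρμ * a ≤ ((R * K)⁻¹) ^ 2 := by
      have h2 : ρμ * a ^ 3 ≤ (R * K)⁻¹ ^ 2 * a ^ 2 := hρc.trans (min_le_right _ _)
      have h3 : ρμ * a * a ^ 2 ≤ (R * K)⁻¹ ^ 2 * a ^ 2 := by nlinarith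
      exact le_of_mul_le_mul_right h3 (by positivity)
    have h4 : Real.sqrt (ρμ * a) ≤ (R * K)⁻¹ := by
      rw [← Real.sqrt_sq (by positivity : 0 ≤ (R * K)⁻¹)]
      exact Real.sqrt_le_sqrt h1
    rw [hℓdef, boxLength]
    rw [le_inv_comm₀ hRpos (by positivity)]
    calc K * Real.sqrt (ρμ * a) ≤ K * (R * K)⁻¹ := by gcongr
      _ = R⁻¹ := by field_simp
  -- Theorem 2.1 on the sectors of the box `Λ(u)`, for bounded symmetric states
  have HΦ : ∀ (M : ℕ) (Φ : Config M → ℂ), Measurable Φ → (∃ M' : ℝ, ∀ X, ‖Φ X‖ ≤ M') →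
      (∀ (σ : Equiv.Perm (Fin M)) (X : Config M), Φ (X ∘ σ) = Φ X) →
      (∫⁻ X in boxConfig M ℓ u, attrBoxN v ω χ ℓ ρμ u X * (‖Φ X‖₊ : ℝ≥0∞) ^ 2) ≤
        kinBoxN χ ℓ s b u Φ +
          (∫⁻ X in boxConfig M ℓ u, repBoxN v χ ℓ u X * (‖Φ X‖₊ : ℝ≥0∞) ^ 2) +
          ENNReal.ofReal (4 * Real.pi * ρμ ^ 2 * a * ℓ ^ 3 * (1 + C₀ * (ρμ * a ^ 3) ^ (1 / 2 : ℝ))) *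
            ∫⁻ X in boxConfig M ℓ u, (‖Φ X‖₊ : ℝ≥0∞) ^ 2 :=
    fun M Φ hΦm hΦb hΦs => H ρμ hρμ hρc' M u Φ hΦm hΦb hΦs
  -- notation
  set c₀ : ℝ≥0∞ :=
    ENNReal.ofReal (4 * Real.pi * ρμ ^ 2 * a * ℓ ^ 3 * (1 + C₀ * (ρμ * a ^ 3) ^ (1 / 2 : ℝ))) with hc₀
  set Λ : Set Space := slidingBox ℓ u with hΛdef
  have hΛm : MeasurableSet Λ := measurableSet_slidingBox ℓ u
  have hBm : MeasurableSet ({x : Space | ∀ k : Fin 3, x k - u k ∈ Set.Ico (-(L / 2)) (L / 2)}) := measurableSet_cellAt L u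
  have hEm : ∀ S : Finset (Fin N),
      MeasurableSet (Set.univ.pi fun _ : {i // i ∉ S} => {x : Space | ∀ k : Fin 3, x k - u k ∈ Set.Ico (-(L / 2)) (L / 2)} \ Λ) := fun S =>
    MeasurableSet.univ_pi fun _ => hBm.diff hΛm
  have hoff : ∀ (S : Finset (Fin N)) (Y : {i // i ∉ S} → Space),
      Y ∈ (Set.univ.pi fun _ : {i // i ∉ S} => {x : Space | ∀ k : Fin 3, x k - u k ∈ Set.Ico (-(L / 2)) (L / 2)} \ Λ) → ∀ i, Y i ∉ Λ :=
    fun S Y hY i => (Set.mem_univ_pi.1 hY i).2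
  have hnorm : Measurable fun X : Config N => (‖Ψ.ψ X‖₊ : ℝ≥0∞) ^ 2 := Ψ.measurable_normSq
  -- the three integrands on `Ω'^N` and their sector versions
  set Fa : Config N → ℝ≥0∞ := fun X => attrBoxN v ω χ ℓ ρμ u X * (‖Ψ.ψ X‖₊ : ℝ≥0∞) ^ 2 with hFa
  set Fr : Config N → ℝ≥0∞ := fun X => repBoxN v χ ℓ u X * (‖Ψ.ψ X‖₊ : ℝ≥0∞) ^ 2 with hFr
  set Fn : Config N → ℝ≥0∞ := fun X => (‖Ψ.ψ X‖₊ : ℝ≥0∞) ^ 2 with hFn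
  have hFam : Measurable Fa := (measurable_attrBoxN hvmeas hω.measurable hχ ℓ ρμ u).mul hnorm
  have hFrm : Measurable Fr := (measurable_repBoxN hvmeas hχ ℓ u).mul hnorm
  -- sector quantities
  set A : ∀ S : Finset (Fin N), ({i // i ∉ S} → Space) → ℝ≥0∞ := fun S Y =>
    ∫⁻ Z in boxConfig S.card ℓ u, attrBoxN v ω χ ℓ ρμ u Z *
      (‖Ψ.ψ ((MeasurableEquiv.trans (MeasurableEquiv.piEquivPiSubtypeProd (fun _ : Fin _ => Space) (fun i => i ∈ S)) (MeasurableEquiv.prodCongr (MeasurableEquiv.symm (MeasurableEquiv.piCongrLeft (fun _ : {i // i ∈ S} => Space) (RelIso.toEquiv (Finset.orderIsoOfFin S rfl)))) (MeasurableEquiv.refl ({i // i ∉ S} → Space)))).symm (Z, Y))‖₊ : ℝ≥0∞) ^ 2 with hA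
  set Rr : ∀ S : Finset (Fin N), ({i // i ∉ S} → Space) → ℝ≥0∞ := fun S Y =>
    ∫⁻ Z in boxConfig S.card ℓ u, repBoxN v χ ℓ u Z *
      (‖Ψ.ψ ((MeasurableEquiv.trans (MeasurableEquiv.piEquivPiSubtypeProd (fun _ : Fin _ => Space) (fun i => i ∈ S)) (MeasurableEquiv.prodCongr (MeasurableEquiv.symm (MeasurableEquiv.piCongrLeft (fun _ : {i // i ∈ S} => Space) (RelIso.toEquiv (Finset.orderIsoOfFin S rfl)))) (MeasurableEquiv.refl ({i // i ∉ S} → Space)))).symm (Z, Y))‖₊ : ℝ≥0∞) ^ 2 with hRr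
  set Nm : ∀ S : Finset (Fin N), ({i // i ∉ S} → Space) → ℝ≥0∞ := fun S Y =>
    ∫⁻ Z in boxConfig S.card ℓ u, (‖Ψ.ψ ((MeasurableEquiv.trans (MeasurableEquiv.piEquivPiSubtypeProd (fun _ : Fin _ => Space) (fun i => i ∈ S)) (MeasurableEquiv.prodCongr (MeasurableEquiv.symm (MeasurableEquiv.piCongrLeft (fun _ : {i // i ∈ S} => Space) (RelIso.toEquiv (Finset.orderIsoOfFin S rfl)))) (MeasurableEquiv.refl ({i // i ∉ S} → Space)))).symm (Z, Y))‖₊ : ℝ≥0∞) ^ 2 with hNm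
  set Kn : ∀ S : Finset (Fin N), ({i // i ∉ S} → Space) → ℝ≥0∞ := fun S Y =>
    kinBoxN χ ℓ s b u (fun Z => Ψ.ψ ((MeasurableEquiv.trans (MeasurableEquiv.piEquivPiSubtypeProd (fun _ : Fin _ => Space) (fun i => i ∈ S)) (MeasurableEquiv.prodCongr (MeasurableEquiv.symm (MeasurableEquiv.piCongrLeft (fun _ : {i // i ∈ S} => Space) (RelIso.toEquiv (Finset.orderIsoOfFin S rfl)))) (MeasurableEquiv.refl ({i // i ∉ S} → Space)))).symm (Z, Y))) with hKn
  -- measurability in `Y`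
  have hRrm : ∀ S, Measurable (Rr S) := fun S => by
    have h1 : Measurable fun q : Config S.card × ({i // i ∉ S} → Space) =>
        repBoxN v χ ℓ u q.1 * (‖Ψ.ψ ((MeasurableEquiv.trans (MeasurableEquiv.piEquivPiSubtypeProd (fun _ : Fin _ => Space) (fun i => i ∈ S)) (MeasurableEquiv.prodCongr (MeasurableEquiv.symm (MeasurableEquiv.piCongrLeft (fun _ : {i // i ∈ S} => Space) (RelIso.toEquiv (Finset.orderIsoOfFin S rfl)))) (MeasurableEquiv.refl ({i // i ∉ S} → Space)))).symm q)‖₊ : ℝ≥0∞) ^ 2 := by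
      have h := ((measurable_repBoxN hvmeas hχ ℓ u).comp measurable_fst).mul
        (hnorm.comp (MeasurableEquiv.trans (MeasurableEquiv.piEquivPiSubtypeProd (fun _ : Fin _ => Space) (fun i => i ∈ S)) (MeasurableEquiv.prodCongr (MeasurableEquiv.symm (MeasurableEquiv.piCongrLeft (fun _ : {i // i ∈ S} => Space) (RelIso.toEquiv (Finset.orderIsoOfFin S rfl)))) (MeasurableEquiv.refl ({i // i ∉ S} → Space)))).symm.measurable)
      exact h
    have h := h1.lintegral_prod_left' (μ := (volume : Measure (Config S.card)).restrict (boxConfig S.card ℓ u))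
    exact h
  have hNmm : ∀ S, Measurable (Nm S) := fun S => by
    have h1 : Measurable fun q : Config S.card × ({i // i ∉ S} → Space) =>
        (‖Ψ.ψ ((MeasurableEquiv.trans (MeasurableEquiv.piEquivPiSubtypeProd (fun _ : Fin _ => Space) (fun i => i ∈ S)) (MeasurableEquiv.prodCongr (MeasurableEquiv.symm (MeasurableEquiv.piCongrLeft (fun _ : {i // i ∈ S} => Space) (RelIso.toEquiv (Finset.orderIsoOfFin S rfl)))) (MeasurableEquiv.refl ({i // i ∉ S} → Space)))).symm q)‖₊ : ℝ≥0∞) ^ 2 := by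
      have h := hnorm.comp (MeasurableEquiv.trans (MeasurableEquiv.piEquivPiSubtypeProd (fun _ : Fin _ => Space) (fun i => i ∈ S)) (MeasurableEquiv.prodCongr (MeasurableEquiv.symm (MeasurableEquiv.piCongrLeft (fun _ : {i // i ∈ S} => Space) (RelIso.toEquiv (Finset.orderIsoOfFin S rfl)))) (MeasurableEquiv.refl ({i // i ∉ S} → Space)))).symm.measurable
      exact h
    have h := h1.lintegral_prod_left' (μ := (volume : Measure (Config S.card)).restrict (boxConfig S.card ℓ u))
    exact h
  have hKnm : ∀ S, Measurable (Kn S) := fun S => by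
    simp only [hKn, kinBoxN_split_symm]
    refine Finset.measurable_sum _ fun j _ => Measurable.const_mul ?_ _
    have hK : Measurable fun X : Config N =>
        kinLoc χ ℓ s b u fun x => Ψ.ψ (Function.update X ((Finset.orderIsoOfFin S rfl) j) x) := by
      have h := (measurable_kinLoc_slice hχc ℓ s b ((Finset.orderIsoOfFin S rfl) j) hΨc).comp (measurable_prodMk_left (x := u))
      exact h
    have h := (hK.comp (MeasurableEquiv.trans (MeasurableEquiv.piEquivPiSubtypeProd (fun _ : Fin _ => Space) (fun i => i ∈ S)) (MeasurableEquiv.prodCongr (MeasurableEquiv.symm (MeasurableEquiv.piCongrLeft (fun _ : {i // i ∈ S} => Space) (RelIso.toEquiv (Finset.orderIsoOfFin S rfl)))) (MeasurableEquiv.refl ({i // i ∉ S} → Space)))).symm.measurable).lintegral_prod_left'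
      (μ := (volume : Measure (Config S.card)).restrict (boxConfig S.card ℓ u))
    exact h
  -- Theorem 2.1 sector by sector, integrated over `Y` and summed over `S`
  have hsec : ∀ S : Finset (Fin N),
      (∫⁻ Y in Set.univ.pi fun _ : {i // i ∉ S} => {x : Space | ∀ k : Fin 3, x k - u k ∈ Set.Ico (-(L / 2)) (L / 2)} \ Λ, A S Y) ≤
        (∫⁻ Y in Set.univ.pi fun _ : {i // i ∉ S} => {x : Space | ∀ k : Fin 3, x k - u k ∈ Set.Ico (-(L / 2)) (L / 2)} \ Λ, Kn S Y) +
          (∫⁻ Y in Set.univ.pi fun _ : {i // i ∉ S} => {x : Space | ∀ k : Fin 3, x k - u k ∈ Set.Ico (-(L / 2)) (L / 2)} \ Λ, Rr S Y) +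
          c₀ * ∫⁻ Y in Set.univ.pi fun _ : {i // i ∉ S} => {x : Space | ∀ k : Fin 3, x k - u k ∈ Set.Ico (-(L / 2)) (L / 2)} \ Λ, Nm S Y := by
    intro S
    have h1 : ∀ Y, A S Y ≤ Kn S Y + Rr S Y + c₀ * Nm S Y := fun Y =>
      HΦ S.card (fun Z => Ψ.ψ ((MeasurableEquiv.trans (MeasurableEquiv.piEquivPiSubtypeProd (fun _ : Fin _ => Space) (fun i => i ∈ S)) (MeasurableEquiv.prodCongr (MeasurableEquiv.symm (MeasurableEquiv.piCongrLeft (fun _ : {i // i ∈ S} => Space) (RelIso.toEquiv (Finset.orderIsoOfFin S rfl)))) (MeasurableEquiv.refl ({i // i ∉ S} → Space)))).symm (Z, Y)))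
        (measurable_split_symm_left S hΨc.measurable Y) (exists_norm_split_symm_le S hΨbdd Y)
        (symm_split_symm_left S Ψ.symm Y)
    calc (∫⁻ Y in Set.univ.pi fun _ : {i // i ∉ S} => {x : Space | ∀ k : Fin 3, x k - u k ∈ Set.Ico (-(L / 2)) (L / 2)} \ Λ, A S Y)
        ≤ ∫⁻ Y in Set.univ.pi fun _ : {i // i ∉ S} => {x : Space | ∀ k : Fin 3, x k - u k ∈ Set.Ico (-(L / 2)) (L / 2)} \ Λ, (Kn S Y + Rr S Y + c₀ * Nm S Y) :=
          lintegral_mono h1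
      _ = _ := by
          rw [lintegral_add_left (f := fun Y => Kn S Y + Rr S Y) ((hKnm S).add (hRrm S)),
            lintegral_add_left (hKnm S), lintegral_const_mul _ (hNmm S)]
  have hsum := Finset.sum_le_sum fun S (_ : S ∈ (Finset.univ : Finset (Finset (Fin N)))) => hsec S
  rw [Finset.sum_add_distrib, Finset.sum_add_distrib, ← Finset.mul_sum] at hsum
  -- identification of the four global quantities
  -- (a) attraction
  have hattr : (∫⁻ X in cellN N L, attrLocN v ω χ ℓ L ρμ u X * (‖Ψ.ψ X‖₊ : ℝ≥0∞) ^ 2) =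
      ∑ S, ∫⁻ Y in Set.univ.pi fun _ : {i // i ∉ S} => {x : Space | ∀ k : Fin 3, x k - u k ∈ Set.Ico (-(L / 2)) (L / 2)} \ Λ, A S Y := by
    rw [← lintegral_pi_cellAt hL u (G := fun X => attrLocN v ω χ ℓ L ρμ u X * (‖Ψ.ψ X‖₊ : ℝ≥0∞) ^ 2)
      fun X i k => by rw [attrLocN_add_single, Ψ.periodic]]
    rw [setLIntegral_congr_fun (MeasurableSet.univ_pi fun _ => hBm) (g := Fa) fun X hX => by
      simp only [hFa]
      congr 1
      unfold attrLocN attrBoxN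
      congr 1
      refine Finset.sum_congr rfl fun i _ => ?_
      exact lintegral_cell_pairLoc₁Per hχ hvmeas hR hω.measurable hℓ0 hRℓ h2ℓ
        (abs_sub_le_of_mem_cellAt (Set.mem_univ_pi.1 hX i))]
    rw [lintegral_pi_cellAt_eq_sum hℓL u hFam]
    refine Finset.sum_congr rfl fun S _ => setLIntegral_congr_fun (hEm S) fun Y hY => ?_
    simp only [hA, hFa]
    refine lintegral_congr fun Z => ?_
    rw [attrBoxN_split_symm hχ hℓ0 ρμ Z (hoff S Y hY)]
  -- (b) repulsion
  have hrep : (∫⁻ X in cellN N L, repLocN v χ ℓ L u X * (‖Ψ.ψ X‖₊ : ℝ≥0∞) ^ 2) =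
      ∑ S, ∫⁻ Y in Set.univ.pi fun _ : {i // i ∉ S} => {x : Space | ∀ k : Fin 3, x k - u k ∈ Set.Ico (-(L / 2)) (L / 2)} \ Λ, Rr S Y := by
    rw [← lintegral_pi_cellAt hL u (G := fun X => repLocN v χ ℓ L u X * (‖Ψ.ψ X‖₊ : ℝ≥0∞) ^ 2)
      fun X i k => by rw [repLocN_add_single, Ψ.periodic]]
    rw [setLIntegral_congr_fun (MeasurableSet.univ_pi fun _ => hBm) (g := Fr) fun X hX => by
      simp only [hFr]
      congr 1
      unfold repLocN repBoxN
      refine Finset.sum_congr rfl fun i _ => Finset.sum_congr rfl fun j _ => ?_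
      exact pairLocPer_eq_pairLoc hχ hR hℓ0 hRℓ h2ℓ
        (abs_sub_le_of_mem_cellAt (Set.mem_univ_pi.1 hX i))
        (abs_sub_le_of_mem_cellAt (Set.mem_univ_pi.1 hX j))]
    rw [lintegral_pi_cellAt_eq_sum hℓL u hFrm]
    refine Finset.sum_congr rfl fun S _ => setLIntegral_congr_fun (hEm S) fun Y hY => ?_
    simp only [hRr, hFr]
    refine lintegral_congr fun Z => ?_
    rw [repBoxN_split_symm hχ hℓ0 Z (hoff S Y hY)]
  -- (c) normalisation
  have hone : ∑ S, (∫⁻ Y in Set.univ.pi fun _ : {i // i ∉ S} => {x : Space | ∀ k : Fin 3, x k - u k ∈ Set.Ico (-(L / 2)) (L / 2)} \ Λ, Nm S Y) = 1 := by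
    rw [← Ψ.norm_eq, ← lintegral_pi_cellAt hL u (G := Fn) fun X i k => by simp only [hFn, Ψ.periodic],
      lintegral_pi_cellAt_eq_sum hℓL u hnorm]
  -- (d) kinetic energy
  have hkin : ∑ S, (∫⁻ Y in Set.univ.pi fun _ : {i // i ∉ S} => {x : Space | ∀ k : Fin 3, x k - u k ∈ Set.Ico (-(L / 2)) (L / 2)} \ Λ, Kn S Y) =
      kinLocN χ ℓ s b u L Ψ.ψ :=
    sum_lintegral_kinBoxN_split hℓ0 h2ℓ hχc s b u Ψ
  rw [hattr]
  rw [hkin, ← hrep, hone, mul_one] at hsum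
  exact hsum

end Literature.MathematicalPhysics.QuantumManyBody.BoseGas

end
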